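import Summits.SmoothPoincare4.SmoothPoincare4.Theorems.ConvexBisectionAcyclicBisectionExistsSeamPageFunctionModel
import Summits.SmoothPoincare4.SmoothPoincare4.Theorems.ConvexBisectionAcyclicBisectionExistsSeamPageFunctionTube
import Summits.SmoothPoincare4.SmoothPoincare4.Theorems.ConvexBisectionAcyclicBisectionExistsPushedPrefixEmbedding
import Summits.SmoothPoincare4.SmoothPoincare4.Theorems.ConvexBisectionAcyclicBisectionExistsDualHandlePushRegion
import Summits.SmoothPoincare4.SmoothPoincare4.Theorems.ConvexBisectionAcyclicBisectionExistsDualHandlePlumbing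
import Summits.SmoothPoincare4.SmoothPoincare4.Theorems.ConvexBisectionAcyclicBisectionExistsComplementPieceHandleChart
import Summits.SmoothPoincare4.SmoothPoincare4.Theorems.ConvexBisectionAcyclicBisectionExistsBeltPageLimit
import HarnessLib

/-!
# The seam page function, IV: the page-angle AGREEMENT of the `X`-reading and the `W`-reading
(brick X5-1 of clause (ii) "the seam page function `F : ∂X₁ → ℂ`" of the registered stub
`stub_T3_dualPresentation` (T3), line `modp-braid-orbits`, crux `ConvexBisection.AcyclicBisectionExists`,
item stmt-SmoothPoincare4-10508; wave 5, lead c5)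

Over the T3b data (`D`, standard form `G`, compatible split `D₁, D₂'`, Y5's pushed prefix embedding
`jX₁` with clauses (a)(b), a complement piece `(W₂, b₂, jW₂, φ)` with Y6's seam identity, X1's dual data
`D₂` through its clauses (E1) "`jW₂ ∘ D₂.jA = G.jN` off the dual tube ranges" and (F1)
"`jW₂ (D₂.jB j zb) = G.jM (D.jB (f j) b)` when `b = modelF zb`", and the page clause):
**`w_agree_of_dualData`** — at a point of `∂X₁` that is both `X₁`-unsurgered (`incl y = D₁.jA a`) and
`W₂`-unsurgered (`b₂.incl (φ y) = D₂.jA a'`), `w(a') = c · w(a)` with `c > 0`.  Inside the dual tubes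
the swap symmetry `modelPush ∘ dualVec = modelF ∘ α` (`…SeamPageFunctionModel.lean`) shows that both
readings are taken at the same point of the attaching tube of the base.  Everything here is proved.

## References
* A. A. Kosinski, *Differential Manifolds* (1993), VI §6. [Kosinski1993]
* J. Milnor, *Lectures on the h-cobordism theorem* (1965), §3. [MilnorHCobordism1965]
-/

noncomputable section

-- the prescribed namespace `Summit.<P>.<Sub>.…` duplicates `SmoothPoincare4` (P = Sub)
set_option linter.dupNamespace false

open scoped Manifold ContDiff Topology

namespace Summit.SmoothPoincare4.SmoothPoincare4.Theorems.AcyclicBisectionExists.ModpBraidOrbits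

open Set Function Metric
open Literature.Topology.FourManifolds Literature.Topology.FourManifolds.HandleAttachingMap
  Literature.Topology.FourManifolds.LefschetzBase
open PushModel BeltPageClause

/-! ### §1 The `W`-reading's model point -/

section Prep

variable {κ δ aC : ℝ}

/-- **The `W`-reading's model point is a belt piece point**: for `y' ∈ T ∩ ∂D⁴` off `S`,
`modelF (α y') = modelPush (dualVec y')` lies in the closed ball, off `S`, with non-zero `μ`-part.
[folklore] -/
theorem exists_beltPiece_coe_eq_modelF (ha : 0 < aC) (hκ : 0 < κ) (hκ2 : κ ≤ 1 / 2) (hκ1 : κ ≤ 1)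
    (hδ : 0 < δ) (hδ2 : δ ≤ 1 / 2) (y : ↥(handleTube 3 2)) (hd : tubeDepth y = 0)
    (hS : lamSq 2 (tubeVec y) < 1) :
    ∃ b : ↥(beltPiece 3 2),
      ((b : closedBall (0 : EuclideanSpace ℝ (Fin 4)) 1) : EuclideanSpace ℝ (Fin 4)) =
        modelF aC κ δ (handleInversion 2 (tubeVec y)) ∧
      muPart ((b : closedBall (0 : EuclideanSpace ℝ (Fin 4)) 1) : EuclideanSpace ℝ (Fin 4)) ≠ 0 := by
  have hmodel := modelPush_dualVec ha hκ hκ2 hδ hδ2 y hd hS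
  have hl : lamPart (dualVec aC κ δ y) ≠ 0 := lamPart_dualVec_ne_zero hκ y hd hS
  have hn : ‖dualVec aC κ δ y‖ = 1 := norm_dualVec_eq_one ha hκ hκ1 hδ hδ2 y hd
  have hxn : ‖modelPush κ δ (dualVec aC κ δ y)‖ ≤ 1 := (modelPush_mem_pushTarget hκ hκ2 hδ hδ2 hl hn.le).1
  have hκ' : κ ^ 2 ≤ 1 / 4 := by nlinarith
  have hxS : lamSq 2 (modelPush κ δ (dualVec aC κ δ y)) ≠ 1 := by
    rw [← sOf_eq_lamSq, sOf_modelPush hκ hl]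
    have h1 : sOf (dualVec aC κ δ y) < 1 := by
      have := norm_lamPart_dualVec_lt hκ y (a := aC) (δ := δ)
      rw [sOf]
      nlinarith [norm_nonneg (lamPart (dualVec aC κ δ y))]
    rcases lt_or_ge (sOf (dualVec aC κ δ y)) (κ ^ 2 / 2) with hlt | hge
    · have := (pushP_mem (q := muScaleSq κ δ (sOf (dualVec aC κ δ y)) * muN (dualVec aC κ δ y) / δ) hκ hlt).2
      linarith
    · rw [pushP_of_ge _ hge]; exact h1.ne
  have hμ : muPart (modelPush κ δ (dualVec aC κ δ y)) ≠ 0 := by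
    rw [modelPush, muPart_torusScale]
    exact smul_ne_zero (Real.sqrt_pos.2 (muScaleSq_pos hκ hκ2 hδ (sOf_pos_iff.2 hl))).ne'
      (muPart_dualVec_ne_zero ha hκ hκ1 hδ hδ2 y)
  exact ⟨⟨⟨modelPush κ δ (dualVec aC κ δ y), mem_closedBall_zero_iff.2 hxn⟩, hxS⟩, hmodel, hμ⟩

end Prep
/-! ### §2 The agreement -/

section Agreement

variable {g : ℕ} {ι : Type} [Finite ι] {h : ι → HandleAttachingMap 3 2 (Base g)}
  {X : Type} [TopologicalSpace X] [ChartedSpace (EuclideanHalfSpace 4) X] [IsManifold (𝓡∂ 4) ∞ X]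
  {bX : BoundaryData (𝓡∂ 4) X (𝓡 3)} [Nonempty bX.carrier]
  {ι₁ : Type} [Finite ι₁] {ι' : Type} [Finite ι']
  {X₁ : Type} [TopologicalSpace X₁] [T2Space X₁] [ChartedSpace (EuclideanHalfSpace 4) X₁]
  [IsManifold (𝓡∂ 4) ∞ X₁]
  {W₂ : Type} [TopologicalSpace W₂] [ChartedSpace (EuclideanHalfSpace 4) W₂]

omit [Finite ι₁] [Finite ι'] [T2Space X₁] [IsManifold (𝓡∂ 4) ∞ X₁] in
/-- **The dual attaching map at a BOUNDARY tube point, in the handle chart**: for `y' ∈ T ∩ ∂D⁴`,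
`jN (dualMap_j y') = jM (D.jB (f j) (dualVec y'))` (V5 `jN_dualMap_eq_modelChart` and
`modelChart_of_norm_le_one` at norm `1`). [cite: MilnorHCobordism1965, §3] -/
theorem jN_dualMap_of_depth_zero (D : MultiAttachmentData h (𝓡∂ 4) X) (G : BoundaryGlueData bX (bBase g))
    (f : ι' → ι) {aC κ δ : ℝ} (ha : 0 < aC) (hκ : 0 < κ) (hκ2 : κ ≤ 1 / 2) (hκ1 : κ ≤ 1) (hδ : 0 < δ)
    (hδ2 : δ ≤ 1 / 2) (col : (BoundaryManifold.boundaryData 3 (Base g)).Collar)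
    (hCM : ∀ j, CollarAdapted D (f j) G aC)
    (hcol : ∀ (w : (BoundaryManifold.boundaryData 3 (Base g)).carrier) (x : (bBase g).carrier),
      (BoundaryManifold.boundaryData 3 (Base g)).incl w = (bBase g).incl x →
      ∀ t : Set.Icc (0 : ℝ) 1, col.toFun (w, t) = G.CN.toFun x ((t : ℝ) / (2 - t)))
    (j : ι') (y' : ↥(handleTube 3 2)) (hd : tubeDepth y' = 0) :
    ∃ b : ↥(beltPiece 3 2),
      ((b : closedBall (0 : EuclideanSpace ℝ (Fin 4)) 1) : EuclideanSpace ℝ (Fin 4)) = dualVec aC κ δ y' ∧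
      G.jN ((dualMap D bX (bBase g) G.φ col κ δ hκ hκ1 hδ hδ2 (f j)).toFun y') = G.jM (D.jB (f j) b) := by
  have hdVn := norm_dualVec_eq_one ha hκ hκ1 hδ hδ2 y' hd (aC := aC)
  have hμ : muPart (dualVec aC κ δ y') ≠ 0 := muPart_dualVec_ne_zero ha hκ hκ1 hδ hδ2 y'
  have hlam : ‖lamPart (dualVec aC κ δ y')‖ ≤ 1 / 2 := ((norm_lamPart_dualVec_lt hκ y').trans_le hκ2).le
  have hd1 : 1 - ‖dualVec aC κ δ y'‖ ^ 2 ≤ min (1 / 5) aC := by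
    rw [hdVn, one_pow, sub_self]; exact le_min (by norm_num) ha.le
  have hda : 1 - ‖dualVec aC κ δ y'‖ ^ 2 < aC := by rw [hdVn, one_pow, sub_self]; exact ha
  exact ⟨_, rfl, by rw [jN_dualMap_eq_modelChart D (f j) G ha hκ hκ1 hδ hδ2 col hcol y',
    modelChart_of_norm_le_one D (f j) bX G ha (hCM j) hμ hlam hdVn.le hd1 hda]⟩

omit [Nonempty bX.carrier] in
/-- **A dual-unsurgered BOUNDARY point inside a dual tube**: `a' = ḡ'_j y'` with `a' ∈ ∂ Base g`
forces `y' ∈ ∂D⁴` off `S`, and `D₂.jA a' = D₂.jB j (α y')` (Kosinski's identification). [cite: Kosinski1993, VI §6] -/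
theorem dual_tube_point (D : MultiAttachmentData h (𝓡∂ 4) X) (G : BoundaryGlueData bX (bBase g))
    (f : ι' → ι) {κ δ : ℝ} (hκ : 0 < κ) (hκ1 : κ ≤ 1) (hδ : 0 < δ) (hδ2 : δ ≤ 1 / 2)
    (col : (BoundaryManifold.boundaryData 3 (Base g)).Collar)
    (D₂ : MultiAttachmentData
      (fun j : ι' => dualMap D bX (bBase g) G.φ col κ δ hκ hκ1 hδ hδ2 (f j)) (𝓡∂ 4) W₂)
    (a' : ↥(coresComplement fun j : ι' => dualMap D bX (bBase g) G.φ col κ δ hκ hκ1 hδ hδ2 (f j)))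
    (ha'b : (a' : Base g) ∈ (𝓡∂ 4).boundary (Base g)) (j : ι') (y' : ↥(handleTube 3 2))
    (hy' : (dualMap D bX (bBase g) G.φ col κ δ hκ hκ1 hδ hδ2 (f j)).toFun y' = (a' : Base g)) :
    ∃ hS : lamSq 2 (tubeVec y') ≠ 1, tubeDepth y' = 0 ∧ lamSq 2 (tubeVec y') < 1 ∧
      D₂.jA a' = D₂.jB j ⟨handleInversionPt (y' : closedBall (0 : EuclideanSpace ℝ (Fin 4)) 1) y'.2 hS,
        (handleInversion_mem y'.2 hS).2.2⟩ := by
  have hS : lamSq 2 (tubeVec y') ≠ 1 :=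
    (apply_mem_coresComplement_iff D₂.disjoint j y').1 (hy'.symm ▸ a'.2)
  refine ⟨hS, ?_, lamSq_tubeVec_lt_one_of_ne y' hS, ?_⟩
  · rw [tubeDepth_eq_zero_iff]
    exact norm_eq_one_of_apply_mem_boundary _ y' (hy'.symm ▸ ha'b)
  · rw [D₂.glue]
    have : (a' : Base g) = (dualMap D bX (bBase g) G.φ col κ δ hκ hκ1 hδ hδ2 (f j)).toFun y' := hy'.symm
    rw [this]
    exact glueRel_apply _ y' hS

/-- **THE PAGE-ANGLE AGREEMENT of the `X`-reading and the `W`-reading on common seam points.**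
Data: `D, G` (standard form), prefix/suffix index maps `e, f` (jointly covering `ι`, `f` injective,
disjoint ranges), `D₁, D₂'` (compatible split, V5), constants, `col, hCM, hcol`, Y5's `jX₁` with
clauses (a), (b), a complement piece `(W₂, b₂, jW₂, φ)` with the seam identity, X1's dual data `D₂`
with (E1), (F1), and the page clause.  Conclusion: `incl y = D₁.jA a` and `b₂.incl (φ y) = D₂.jA a'`
imply `w(a') = c w(a)`, `c > 0`. [cite: Kosinski1993, VI §6] -/
theorem w_agree_of_dualData (D : MultiAttachmentData h (𝓡∂ 4) X) (G : BoundaryGlueData bX (bBase g))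
    (e : ι₁ → ι) (f : ι' → ι) (hf : Injective f) (hef : ∀ i, i ∈ range e ∨ i ∈ range f)
    (hdisj : ∀ (j : ι') (i : ι₁), Disjoint (range (h (f j)).toFun) (range (h (e i)).toFun))
    (D₁ : MultiAttachmentData (fun i => h (e i)) (𝓡∂ 4) X₁)
    (D₂' : MultiAttachmentData (fun j => D₁.lift (h (f j)) (hdisj j)) (𝓡∂ 4) X)
    (hA : ∀ (a : ↥(coresComplement h)) (ha₁ : (a : Base g) ∈ coresComplement fun i => h (e i))
      (ha₂ : D₁.jA ⟨a, ha₁⟩ ∈ coresComplement fun j => D₁.lift (h (f j)) (hdisj j)),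
      D₂'.jA ⟨D₁.jA ⟨a, ha₁⟩, ha₂⟩ = D.jA a)
    (hC : ∀ (j : ι') (b : ↥(beltPiece 3 2)), D₂'.jB j b = D.jB (f j) b)
    {aC κ δ : ℝ} (ha : 0 < aC) (hκ : 0 < κ) (hκ2 : κ ≤ 1 / 2) (hκ1 : κ ≤ 1) (hδ : 0 < δ)
    (hδ2 : δ ≤ 1 / 2) (col : (BoundaryManifold.boundaryData 3 (Base g)).Collar)
    (hCM : ∀ j, CollarAdapted D (f j) G aC)
    (hcol : ∀ (w : (BoundaryManifold.boundaryData 3 (Base g)).carrier) (x : (bBase g).carrier),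
      (BoundaryManifold.boundaryData 3 (Base g)).incl w = (bBase g).incl x →
      ∀ t : Set.Icc (0 : ℝ) 1, col.toFun (w, t) = G.CN.toFun x ((t : ℝ) / (2 - t)))
    {jX₁ : X₁ → G.d₂.Glued}
    (hYa : ∀ (p : X₁) (hp : p ∈ coresComplement fun j => D₁.lift (h (f j)) (hdisj j)),
      (∀ (j : ι') (y : ↥(handleTube 3 2)), (D₁.lift (h (f j)) (hdisj j)).toFun y = p →
        ‖lamPart ((y : closedBall (0 : EuclideanSpace ℝ (Fin 4)) 1) : EuclideanSpace ℝ (Fin 4))‖ ^ 2 ≤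
          1 - 3 * κ ^ 2 / 4) →
      jX₁ p = G.jM (D₂'.jA ⟨p, hp⟩))
    (hYb : ∀ (j : ι') (y : ↥(handleTube 3 2)) (b : ↥(beltPiece 3 2)),
      ((b : closedBall (0 : EuclideanSpace ℝ (Fin 4)) 1) : EuclideanSpace ℝ (Fin 4)) =
        handleInversion 2 (selfPush κ δ
          ((y : closedBall (0 : EuclideanSpace ℝ (Fin 4)) 1) : EuclideanSpace ℝ (Fin 4))) →
      jX₁ ((D₁.lift (h (f j)) (hdisj j)).toFun y) = G.jM (D₂'.jB j b))
    (b₂ : BoundaryData (𝓡∂ 4) W₂ (𝓡 3)) (jW₂ : W₂ → G.d₂.Glued)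
    (φ : (BoundaryManifold.boundaryData 3 X₁).carrier → b₂.carrier)
    (hseamId : ∀ z, jW₂ (b₂.incl (φ z)) = jX₁ ((BoundaryManifold.boundaryData 3 X₁).incl z))
    (D₂ : MultiAttachmentData
      (fun j : ι' => dualMap D bX (bBase g) G.φ col κ δ hκ hκ1 hδ hδ2 (f j)) (𝓡∂ 4) W₂)
    (hE1 : ∀ (w : Base g)
      (hw : w ∈ coresComplement fun j : ι' => dualMap D bX (bBase g) G.φ col κ δ hκ hκ1 hδ hδ2 (f j)),
      (∀ (j : ι') (y : ↥(handleTube 3 2)),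
        (dualMap D bX (bBase g) G.φ col κ δ hκ hκ1 hδ hδ2 (f j)).toFun y ≠ w) →
      jW₂ (D₂.jA ⟨w, hw⟩) = G.jN w)
    (hF1 : ∀ (j : ι') (zb b : ↥(beltPiece 3 2)),
      ((b : closedBall (0 : EuclideanSpace ℝ (Fin 4)) 1) : EuclideanSpace ℝ (Fin 4)) =
        modelF aC κ δ ((zb : closedBall (0 : EuclideanSpace ℝ (Fin 4)) 1) : EuclideanSpace ℝ (Fin 4)) →
      jW₂ (D₂.jB j zb) = G.jM (D.jB (f j) b))
    (hpage : ∀ (y : bX.carrier) (a : ↥(coresComplement h)), bX.incl y = D.jA a →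
      ∃ c : ℝ, 0 < c ∧ w g ((bBase g).incl (G.φ y)).1 = (c : ℂ) * w g (a : Base g).1)
    (y : (BoundaryManifold.boundaryData 3 X₁).carrier) (a : ↥(coresComplement fun i => h (e i)))
    (a' : ↥(coresComplement fun j : ι' => dualMap D bX (bBase g) G.φ col κ δ hκ hκ1 hδ hδ2 (f j)))
    (hy : (BoundaryManifold.boundaryData 3 X₁).incl y = D₁.jA a) (ha' : b₂.incl (φ y) = D₂.jA a') :
    ∃ c : ℝ, 0 < c ∧ w g (a' : Base g).1 = (c : ℂ) * w g (a : Base g).1 := by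
  classical
  have hmeet : jW₂ (D₂.jA a') = jX₁ ((BoundaryManifold.boundaryData 3 X₁).incl y) := by rw [← ha', hseamId]
  have hpb : (BoundaryManifold.boundaryData 3 X₁).incl y ∈ (𝓡∂ 4).boundary X₁ := by
    rw [← (BoundaryManifold.boundaryData 3 X₁).range_incl]; exact mem_range_self y
  have ha'b : (a' : Base g) ∈ (𝓡∂ 4).boundary (Base g) := by
    have h1 : D₂.jA a' ∈ (𝓡∂ 4).boundary W₂ := by rw [← ha', ← b₂.range_incl]; exact mem_range_self _
    exact (mem_boundary_opens_iff _ a').1 ((mem_boundary_iff_of_isSmoothEmbedding D₂.hjA D₂.hjAo a').1 h1)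
  have key : ∀ (a₀ : ↥(coresComplement h)), (a₀ : Base g) = (a : Base g) →
      G.jM (D.jA a₀) = G.jN (a' : Base g) →
      ∃ c : ℝ, 0 < c ∧ w g (a' : Base g).1 = (c : ℂ) * w g (a : Base g).1 := by
    intro a₀ ha₀ hMN
    obtain ⟨z, hz, hz'⟩ := G.jM_eq_jN_iff.1 hMN
    obtain ⟨c, hc, hcw⟩ := hpage z a₀ hz.symm
    refine ⟨c, hc, ?_⟩
    have : (a' : Base g) = (bBase g).incl (G.φ z) := hz'
    rw [this, hcw, ha₀]
  have hWI : (∀ (j : ι') (y' : ↥(handleTube 3 2)),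
      (dualMap D bX (bBase g) G.φ col κ δ hκ hκ1 hδ hδ2 (f j)).toFun y' ≠ (a' : Base g)) →
      jW₂ (D₂.jA a') = G.jN (a' : Base g) := fun hdual => by
    have := hE1 (a' : Base g) a'.2 hdual
    simpa using this
  by_cases hsuf : ∃ (j : ι') (t : ↥(handleTube 3 2)), (h (f j)).toFun t = (a : Base g)
  · -- (ii) `a = h (f j₂) t`: `jX₁ (incl y) = jM (D.jB (f j₂) bX')`, `bX' = α (selfPush t)`
    obtain ⟨j₂, t, ht⟩ := hsuf
    have hpt : (BoundaryManifold.boundaryData 3 X₁).incl y = (D₁.lift (h (f j₂)) (hdisj j₂)).toFun t := by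
      rw [hy, MultiAttachmentData.lift_apply]
      congr 1
      exact Subtype.ext ht.symm
    have htn : ‖tubeVec t‖ = 1 :=
      norm_eq_one_of_apply_mem_boundary (D₁.lift (h (f j₂)) (hdisj j₂)) t (hpt ▸ hpb)
    obtain ⟨bX', hbX'⟩ := exists_beltPiece_coe_eq_selfPush hκ hκ2 hδ hδ2 t
    have hX : jX₁ ((BoundaryManifold.boundaryData 3 X₁).incl y) = G.jM (D.jB (f j₂) bX') := by
      rw [hpt, hYb j₂ t bX' hbX', hC]
    have hWII : ∀ (j : ι') (y' : ↥(handleTube 3 2)),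
        (dualMap D bX (bBase g) G.φ col κ δ hκ hκ1 hδ hδ2 (f j)).toFun y' = (a' : Base g) →
        j = j₂ ∧ ((bX' : closedBall (0 : EuclideanSpace ℝ (Fin 4)) 1) : EuclideanSpace ℝ (Fin 4)) =
          modelF aC κ δ (handleInversion 2 (tubeVec y')) ∧ tubeDepth y' = 0 ∧ lamSq 2 (tubeVec y') < 1 := by
      intro j y' hy'
      obtain ⟨hS', hd', hs', hglue⟩ := dual_tube_point D G f hκ hκ1 hδ hδ2 col D₂ a' ha'b j y' hy'
      obtain ⟨bW, hbW, -⟩ := exists_beltPiece_coe_eq_modelF ha hκ hκ2 hκ1 hδ hδ2 y' hd' hs'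
      have hW : jW₂ (D₂.jA a') = G.jM (D.jB (f j) bW) := by rw [hglue]; exact hF1 j _ bW hbW
      have heq : D.jB (f j) bW = D.jB (f j₂) bX' := G.injective_jM (by rw [← hW, hmeet, hX])
      have hjj : f j = f j₂ := by
        by_contra hne
        exact Set.disjoint_left.1 (D.disjointB hne) (mem_range_self bW) (heq ▸ mem_range_self bX')
      refine ⟨hf hjj, ?_, hd', hs'⟩
      have hj : j = j₂ := hf hjj
      subst hj
      rw [← hbW, D.injective_jB _ heq]
    by_cases hS : lamSq 2 (tubeVec t) = 1
    · -- (ii') `t` on the attaching circle: `bX'` is the interior circle point — no `W`-reading exists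
      exfalso
      obtain ⟨hμ0, hn1⟩ := handleInversion_selfPush_circle hκ hκ2 hδ (δ := δ) htn.le hS
      rw [tubeVec_mk, ← hbX'] at hμ0 hn1
      by_cases hdual : ∃ (j : ι') (y' : ↥(handleTube 3 2)),
          (dualMap D bX (bBase g) G.φ col κ δ hκ hκ1 hδ hδ2 (f j)).toFun y' = (a' : Base g)
      · obtain ⟨j, y', hy'⟩ := hdual
        obtain ⟨-, hbb, hd', hs'⟩ := hWII j y' hy'
        obtain ⟨bW, hbW, hμ⟩ := exists_beltPiece_coe_eq_modelF ha hκ hκ2 hκ1 hδ hδ2 y' hd' hs'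
        rw [hbW, ← hbb] at hμ
        exact hμ hμ0
      · push Not at hdual
        obtain ⟨z, hz, -⟩ := G.jM_eq_jN_iff.1 (by rw [← hX, ← hmeet, hWI hdual])
        have hb1 := norm_eq_one_of_jB_mem_boundary D (f j₂) bX'
          (by rw [hz, ← bX.range_incl]; exact mem_range_self z)
        linarith
    · -- (ii) proper: `t ∉ S`, `bX' = modelPush (α t)`, and `D.jB (f j₂) (α t) = D.jA (h (f j₂) t)`
      have hs0 : 0 < sOf (tubeVec t) := by rw [sOf_eq_lamSq]; exact lamSq_tubeVec_pos t
      have hs1 : sOf (tubeVec t) < 1 := by rw [sOf_eq_lamSq]; exact lamSq_tubeVec_lt_one_of_ne t hS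
      have hbX'' : ((bX' : closedBall (0 : EuclideanSpace ℝ (Fin 4)) 1) : EuclideanSpace ℝ (Fin 4)) =
          modelPush κ δ (handleInversion 2 (tubeVec t)) := by
        rw [hbX', ← tubeVec_mk, handleInversion_selfPush hκ hκ2 hδ hs0 hs1]
      have hαl : lamPart (handleInversion 2 (tubeVec t)) ≠ 0 := by
        refine sOf_pos_iff.1 ?_
        rw [sOf_eq_lamSq, lamSq_handleInversion (lamSq_tubeVec_pos t) (lamSq_tubeVec_lt_one_of_ne t hS).le]
        linarith [lamSq_tubeVec_lt_one_of_ne t hS]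
      have hαn : ‖handleInversion 2 (tubeVec t)‖ = 1 :=
        (norm_handleInversion_eq_one_iff htn.le (lamSq_tubeVec_pos t) (lamSq_tubeVec_lt_one_of_ne t hS)).2 htn
      obtain ⟨bT, hbT, haT⟩ : ∃ bT : ↥(beltPiece 3 2),
          ((bT : closedBall (0 : EuclideanSpace ℝ (Fin 4)) 1) : EuclideanSpace ℝ (Fin 4)) =
            handleInversion 2 (tubeVec t) ∧
          D.jA ⟨(h (f j₂)).toFun t, apply_mem_coresComplement_of_lamSq_ne_one D.disjoint (f j₂) t hS⟩ =
            D.jB (f j₂) bT :=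
        ⟨_, rfl, jA_apply_eq_jB D (f j₂) t hS⟩
      refine key ⟨(h (f j₂)).toFun t, apply_mem_coresComplement_of_lamSq_ne_one D.disjoint (f j₂) t hS⟩
        ht ?_
      rw [haT]
      by_cases hdual : ∃ (j : ι') (y' : ↥(handleTube 3 2)),
          (dualMap D bX (bBase g) G.φ col κ δ hκ hκ1 hδ hδ2 (f j)).toFun y' = (a' : Base g)
      · -- (ii)(II): THE HEART — inside the dual tube: `dualVec y' = α t`, then the model chart
        obtain ⟨j, y', hy'⟩ := hdual
        obtain ⟨hj, hbb, hd', hs'⟩ := hWII j y' hy'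
        subst hj
        have hdVl : lamPart (dualVec aC κ δ y') ≠ 0 := lamPart_dualVec_ne_zero hκ y' hd' hs'
        have hvec : modelPush κ δ (dualVec aC κ δ y') = modelPush κ δ (handleInversion 2 (tubeVec t)) := by
          rw [modelPush_dualVec ha hκ hκ2 hδ hδ2 y' hd' hs', ← hbb, hbX'']
        have hdV : dualVec aC κ δ y' = handleInversion 2 (tubeVec t) := by
          have h1 := modelPushInv_modelPush hκ hκ2 hδ hdVl (δ := δ)
          rw [hvec, modelPushInv_modelPush hκ hκ2 hδ hαl] at h1
          exact h1.symm
        obtain ⟨bV, hbV, hchart⟩ := jN_dualMap_of_depth_zero D G f ha hκ hκ2 hκ1 hδ hδ2 col hCM hcol j y' hd'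
        rw [← hy', hchart]
        congr 2
        exact Subtype.ext (Subtype.ext (hbT.trans (hdV.symm.trans hbV.symm)))
      · -- (ii)(I): old seam: `‖modelPush (α t)‖ = 1` forces the push to fix `α t`
        push Not at hdual
        have hMN : G.jM (D.jB (f j₂) bX') = G.jN (a' : Base g) := by rw [← hX, ← hmeet, hWI hdual]
        obtain ⟨z, hz, -⟩ := G.jM_eq_jN_iff.1 hMN
        have hb1 := norm_eq_one_of_jB_mem_boundary D (f j₂) bX'
          (by rw [hz, ← bX.range_incl]; exact mem_range_self z)
        rw [hbX''] at hb1
        have hge : 3 * κ ^ 2 / 4 ≤ sOf (handleInversion 2 (tubeVec t)) := by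
          by_contra hlt
          push Not at hlt
          have := (modelH_modelPush_seam hκ hκ2 hδ hδ2 hαl hαn hlt).2
          linarith
        have hbX3 : bX' = bT :=
          Subtype.ext (Subtype.ext (by rw [hbX'', modelPush_of_ge hκ hge, ← hbT]))
        rw [← hbX3, hMN]
  · -- (i) `a` off all suffix tubes: `jX₁ (incl y) = jM (D.jA a)`
    push Not at hsuf
    have haH : (a : Base g) ∈ coresComplement h := by
      rw [mem_coresComplement]
      intro i hi
      rcases hef i with ⟨i₁, rfl⟩ | ⟨j, rfl⟩
      · exact (mem_coresComplement _).1 a.2 i₁ hi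
      · obtain ⟨t, -, ht⟩ := (mem_core_iff _).1 hi
        exact hsuf j t ht
    have hpc : (BoundaryManifold.boundaryData 3 X₁).incl y ∈
        coresComplement fun j => D₁.lift (h (f j)) (hdisj j) := by
      rw [mem_coresComplement]
      intro j hj
      rw [hy, MultiAttachmentData.jA_mem_core_lift_iff] at hj
      obtain ⟨t, -, ht⟩ := (mem_core_iff _).1 hj
      exact hsuf j t ht
    have hX : jX₁ ((BoundaryManifold.boundaryData 3 X₁).incl y) = G.jM (D.jA ⟨a, haH⟩) := by
      rw [hYa _ hpc]
      · congr 1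
        have hpc' : D₁.jA a ∈ coresComplement fun j => D₁.lift (h (f j)) (hdisj j) := hy ▸ hpc
        rw [← hA ⟨a, haH⟩ a.2 hpc']
        congr 1
        exact Subtype.ext hy
      · intro j t ht
        exfalso
        rw [hy, MultiAttachmentData.lift_apply] at ht
        exact hsuf j t (congrArg (fun b : ↥(coresComplement fun i => h (e i)) => (b : Base g))
          (D₁.injective_jA ht))
    by_cases hdual : ∃ (j : ι') (y' : ↥(handleTube 3 2)),
        (dualMap D bX (bBase g) G.φ col κ δ hκ hκ1 hδ hδ2 (f j)).toFun y' = (a' : Base g)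
    · -- (i)(II): vacuous — `D.jA a = D.jB (f j) bW` would put `a` in the `j`-th suffix tube
      exfalso
      obtain ⟨j, y', hy'⟩ := hdual
      obtain ⟨hS', hd', hs', hglue⟩ := dual_tube_point D G f hκ hκ1 hδ hδ2 col D₂ a' ha'b j y' hy'
      obtain ⟨bW, hbW, -⟩ := exists_beltPiece_coe_eq_modelF ha hκ hκ2 hκ1 hδ hδ2 y' hd' hs'
      have hW : jW₂ (D₂.jA a') = G.jM (D.jB (f j) bW) := by rw [hglue]; exact hF1 j _ bW hbW
      have heq : D.jA ⟨a, haH⟩ = D.jB (f j) bW := G.injective_jM (by rw [← hX, ← hmeet, hW])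
      obtain ⟨t, -, -, ht⟩ := (D.glue (f j) ⟨a, haH⟩ bW).1 heq
      exact hsuf j t ht.symm
    · -- (i)(I): old seam on both sides — the page clause directly
      push Not at hdual
      exact key ⟨a, haH⟩ rfl (by rw [← hX, ← hmeet, hWI hdual])

end Agreement

/-! ### Registered helper -/

/-- **Registered helper `helper_jN_dualMap_of_depth_zero` (anchor of this file; sub-goal of
`stub_T3_dualPresentation`, T3 clause (ii) brick X5-1, wave 5, lead c5): the dual attaching map at a
boundary tube point read in the handle chart, `jN (dualMap_j y') = jM (D.jB (f j) (dualVec y'))`.**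
(The main theorem `w_agree_of_dualData` of this file is too long to register; it rides along.)
[cite: MilnorHCobordism1965, §3] -/
theorem helper_jN_dualMap_of_depth_zero : ∀ {g : ℕ} {ι : Type} [Finite ι] {h : ι → Literature.Topology.FourManifolds.HandleAttachingMap 3 2 (Literature.Topology.FourManifolds.LefschetzBase.Base g)} {X : Type} [TopologicalSpace X] [ChartedSpace (EuclideanHalfSpace 4) X] [IsManifold (𝓡∂ 4) ∞ X] {bX : Literature.Topology.FourManifolds.BoundaryData (𝓡∂ 4) X (𝓡 3)} [Nonempty bX.carrier] {ι' : Type} (D : Literature.Topology.FourManifolds.HandleAttachingMap.MultiAttachmentData h (𝓡∂ 4) X) (G : Literature.Topology.FourManifolds.BoundaryGlueData bX (Literature.Topology.FourManifolds.LefschetzBase.bBase g)) (f : ι' → ι) {aC κ δ : ℝ} (ha : 0 < aC) (hκ : 0 < κ) (hκ2 : κ ≤ 1 / 2) (hκ1 : κ ≤ 1) (hδ : 0 < δ) (hδ2 : δ ≤ 1 / 2) (col : (Literature.Topology.FourManifolds.BoundaryManifold.boundaryData 3 (Literature.Topology.FourManifolds.LefschetzBase.Base g)).Collar), (∀ j,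 Summit.SmoothPoincare4.SmoothPoincare4.Theorems.AcyclicBisectionExists.ModpBraidOrbits.CollarAdapted D (f j) G aC) → (∀ (w : (Literature.Topology.FourManifolds.BoundaryManifold.boundaryData 3 (Literature.Topology.FourManifolds.LefschetzBase.Base g)).carrier) (x : (Literature.Topology.FourManifolds.LefschetzBase.bBase g).carrier), (Literature.Topology.FourManifolds.BoundaryManifold.boundaryData 3 (Literature.Topology.FourManifolds.LefschetzBase.Base g)).incl w = (Literature.Topology.FourManifolds.LefschetzBase.bBase g).incl x → ∀ t : Set.Icc (0 : ℝ) 1, col.toFun (w, t) = G.CN.toFun x ((t : ℝ) / (2 - t))) → ∀ (j : ι') (y' : ↥(Literature.Topology.FourManifolds.handleTube 3 2)), Literature.Topology.FourManifolds.tubeDepth y' = 0 → ∃ b : ↥(Literature.Topology.FourManifolds.beltPiece 3 2), ((b : Metric.closedBall (0 : EuclideanSpace ℝ (Fin 4)) 1) : EuclideanSpace ℝ (Fin 4)) = Summit.SmoothPoincare4.SmoothPoincare4.Theorems.AcyclicBisectionExists.ModpBraidOrbits.dualVec aC κ δ y' ∧ G.jN ((Summit.SmoothPoincare4.SmoothPoincare4.Theorems.AcyclicBisectionExists.ModpBraidOrbits.dualMap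 D bX (Literature.Topology.FourManifolds.LefschetzBase.bBase g) G.φ col κ δ hκ hκ1 hδ hδ2 (f j)).toFun y') = G.jM (D.jB (f j) b) :=
  by
  intro g ι _ h X _ _ _ bX _ ι' D G f aC κ δ ha hκ hκ2 hκ1 hδ hδ2 col hCM hcol j y' hd
  exact jN_dualMap_of_depth_zero D G f ha hκ hκ2 hκ1 hδ hδ2 col hCM hcol j y' hd


end Summit.SmoothPoincare4.SmoothPoincare4.Theorems.AcyclicBisectionExists.ModpBraidOrbits

end
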